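import Literature.NumberTheory.Sieve.PolymathLcmSumsProofs
import Literature.NumberTheory.Sieve.PolymathThetaLevel
import HarnessLib

/-!
# Polymath 8b, §4.2: the Chinese-remainder and multiplicity bookkeeping of Theorem 3.5(i)

Trunk: AntSieve / parity.S13.  Part of the proof of the named fact
`Literature.NumberTheory.Sieve.theta_divisorSumWeights_asymptotic` (**Theorem 3.5(i)** of D. H. J. Polymath,
*Variants of the Selberg sieve, and bounded intervals containing many primes*, Res. Math. Sci. 1:12
(2014) = arXiv:1407.4897, §4.2 "The Elliott–Halberstam case", pp. 13–14), a leaf of the decomposition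
of `Literature.NumberTheory.Sieve.frequently_nth_prime_succ_le_add_polymath` (`H₁ ≤ 246`).  After the
expansion (theta-oo2) of the divisor sums, the inner sum
`S̃(d,d') = ∑_{x ≤ n ≤ 2x, n = b (W), n + h_i = 0 ([d_i,d'_i]) ∀ i} θ(n + h_k)` is handled on p. 13 by
"we may use the Chinese remainder theorem to concatenate the congruence conditions on `n` into a single
primitive congruence condition `n + h_k = a_{W,d_1,…,d'_{k-1}} (q_{W,d_1,…,d'_{k-1}})`", and on p. 14 by
"each choice `q` of `q_{W,d_1,…,d'_{k-1}}` is associated to `O(τ(q)^{O(1)})` choices of `d_1,…,d'_{k-1}`".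
This file PROVES that bookkeeping (elementary; everything is a theorem):

* `LcmEuler.modulusOf W (d, d') = q_{W,d,d'} = W ∏_i [d_i, d'_i]` ((q-def), p. 13);
* `LcmEuler.card_filter_modulusOf_le`: among pairs with squarefree entries satisfying the coprimality
  condition of (multisum), at most `(3k+1)^{ω(q)}` have modulus `q` (a pair is determined by the
  colouring of the primes of `q/W`, `colourOf` / `colourFst_colourOf` of `PolymathLcmSumsColouring.lean`),
  and the regrouped form `LcmEuler.sum_modulusOf_le`:
  `∑_{(d,d')} g(q_{W,d,d'}) ≤ ∑_{q ≤ Q} (3k+1)^{ω(q)} g(q)` for `g ≥ 0`;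
* `LcmEuler.totient_modulusOf`: `φ(q_{W,d,d'}) = φ(W) ∏_i φ([d_i,d'_i])` (so that the main term of (ts) is
  the `φ`-variant of (multisum));
* `LcmEuler.exists_crt_modulusOf` (the concatenation, from `exists_forall_modEq_iff_modEq_prod` of
  `PolymathLcmSums.lean`), `LcmEuler.coprime_residue_modulusOf` (the class `a + h₀` is primitive when
  `b + h₀ ⊥ W` and no prime of a `[d_i,d'_i]` divides `h₀ − h_i`), and
  `LcmEuler.sum_theta_eq_thetaAP`: `S̃(d,d') = thetaAP q r X₁ X₂` (`PolymathThetaLevel.lean`) with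
  `X₁ = ⌈x⌉ + h₀ − 1`, `X₂ = ⌊2x⌋ + h₀`, `r = (a + h₀) mod q`.

## References

* D. H. J. Polymath, *Variants of the Selberg sieve, and bounded intervals containing many primes*,
  Res. Math. Sci. 1 (2014), Art. 12; arXiv:1407.4897, §4.2, pp. 13–14, (theta-oo2), (q-def), (ts).
  [Polymath8b2014]
-/

noncomputable section

open Finset Filter
open scoped BigOperators ArithmeticFunction.omega ArithmeticFunction.Moebius

namespace Literature.NumberTheory.Sieve

namespace LcmEuler

variable {ι : Type*} [Fintype ι] [DecidableEq ι]

/-! ### The modulus `q_{W,d_1,…,d'_{k-1}} = W [d_1,d'_1] ⋯ [d_{k-1},d'_{k-1}]` and its multiplicities -/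

/-- `q_{W,d,d'} := W [d_1,d'_1] ⋯ [d_k,d'_k]` ((q-def), Polymath 8b p. 13). [cite: Polymath8b2014, §4.2, (q-def)] -/
def modulusOf (W : ℕ) (t : (ι → ℕ) × (ι → ℕ)) : ℕ := W * ∏ i, Nat.lcm (t.1 i) (t.2 i)

omit [DecidableEq ι] in
/-- A squarefree divisor of `L` divides the product of the prime factors of `L`. [folklore] -/
theorem dvd_prod_primeFactors_of_squarefree {m L : ℕ} (hm : Squarefree m) (hmL : m ∣ L) (hL : L ≠ 0) :
    m ∣ ∏ p ∈ L.primeFactors, p := by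
  rw [← Nat.prod_primeFactors_of_squarefree hm]
  exact Finset.prod_dvd_prod_of_subset _ _ _ (Nat.primeFactors_mono hmL hL)

/-- **"each choice `q` of `q_{W,d_1,…,d'_{k-1}}` is associated to `O(τ(q)^{O(1)})` choices of
`d_1,…,d_{k-1},d'_1,…,d'_{k-1}`"** (Polymath 8b p. 14), quantitatively: among pairs `(d, d')` with squarefree
entries satisfying the coprimality condition of (multisum), at most `(3k+1)^{ω(q)}` have modulus `q` (a
pair is determined by the colouring of the primes of `q/W`, `PolymathLcmSumsColouring.lean`).
[cite: Polymath8b2014, §4.2, p. 14] -/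
theorem card_filter_modulusOf_le {W : ℕ} (hW : 0 < W) (S : Finset ((ι → ℕ) × (ι → ℕ)))
    (hS : ∀ t ∈ S, LcmCoprime W t.1 t.2 ∧ ∀ i, Squarefree (t.1 i) ∧ Squarefree (t.2 i)) (q : ℕ) :
    #(S.filter fun t => modulusOf W t = q) ≤ (3 * Fintype.card ι + 1) ^ ω q := by
  classical
  by_cases hWq : ¬ W ∣ q
  · have hempty : S.filter (fun t => modulusOf W t = q) = ∅ :=
      Finset.filter_eq_empty_iff.2 fun t _ htq => hWq ⟨_, htq.symm⟩
    rw [hempty, Finset.card_empty]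
    exact Nat.zero_le _
  push Not at hWq
  rcases Nat.eq_zero_or_pos q with hq0 | hqpos
  · -- `q = 0` has empty fibre too (`W > 0` and the entries are squarefree)
    have hempty : S.filter (fun t => modulusOf W t = q) = ∅ := by
      refine Finset.filter_eq_empty_iff.2 fun t ht htq => ?_
      obtain ⟨_, hsq⟩ := hS t ht
      rw [hq0, modulusOf] at htq
      rcases Nat.mul_eq_zero.1 htq with h | h
      · omega
      · exact (Finset.prod_ne_zero_iff.2 fun i _ =>
          Nat.lcm_ne_zero (hsq i).1.ne_zero (hsq i).2.ne_zero) h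
    rw [hempty, Finset.card_empty]
    exact Nat.zero_le _
  set L : ℕ := q / W with hL
  set P : Finset ℕ := L.primeFactors with hPdef
  have hP : ∀ p ∈ P, p.Prime := fun p hp => Nat.prime_of_mem_primeFactors hp
  -- facts about members of the fibre
  have hmem : ∀ t ∈ S.filter (fun t => modulusOf W t = q),
      PairwiseCoprimeLcm t ∧ (∀ j, t.1 j ∣ ∏ p ∈ P, p) ∧ (∀ j, t.2 j ∣ ∏ p ∈ P, p) := by
    intro t ht
    obtain ⟨htS, htq⟩ := Finset.mem_filter.1 ht
    obtain ⟨hadm, hsq⟩ := hS t htS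
    have hprod : ∏ i, Nat.lcm (t.1 i) (t.2 i) = L := by
      rw [hL, ← htq, modulusOf, Nat.mul_div_cancel_left _ hW]
    have hL0 : L ≠ 0 := by
      rw [← hprod]
      exact Finset.prod_ne_zero_iff.2 fun i _ =>
        Nat.lcm_ne_zero (hsq i).1.ne_zero (hsq i).2.ne_zero
    refine ⟨hadm.1, fun j => ?_, fun j => ?_⟩
    · refine dvd_prod_primeFactors_of_squarefree (hsq j).1 ?_ hL0
      rw [← hprod]
      exact (Nat.dvd_lcm_left _ _).trans (Finset.dvd_prod_of_mem _ (Finset.mem_univ j))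
    · refine dvd_prod_primeFactors_of_squarefree (hsq j).2 ?_ hL0
      rw [← hprod]
      exact (Nat.dvd_lcm_right _ _).trans (Finset.dvd_prod_of_mem _ (Finset.mem_univ j))
  -- the injection into colourings of `P`
  have hinj : Set.InjOn (fun t : (ι → ℕ) × (ι → ℕ) => colourOf (P := P) t)
      (S.filter (fun t => modulusOf W t = q) : Set ((ι → ℕ) × (ι → ℕ))) := by
    intro t ht t' ht' heq
    obtain ⟨hpw, hd1, hd2⟩ := hmem t (Finset.mem_coe.1 ht)
    obtain ⟨hpw', hd1', hd2'⟩ := hmem t' (Finset.mem_coe.1 ht')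
    refine Prod.ext (funext fun j => ?_) (funext fun j => ?_)
    · rw [← colourFst_colourOf hP hpw hd1 j, ← colourFst_colourOf hP hpw' hd1' j]
      exact congrArg (fun c => colourFst P c j) heq
    · rw [← colourSnd_colourOf hP hpw hd2 j, ← colourSnd_colourOf hP hpw' hd2' j]
      exact congrArg (fun c => colourSnd P c j) heq
  have hcard := Finset.card_le_card_of_injOn (fun t => colourOf (P := P) t)
    (fun t _ => Finset.mem_univ _) hinj
  refine hcard.trans ?_
  rw [Finset.card_univ, Fintype.card_fun, Fintype.card_coe]
  have hcol : Fintype.card (Colour ι) = 3 * Fintype.card ι + 1 := by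
    simp only [Colour, Fintype.card_option, Fintype.card_prod, Fintype.card_fin]; ring
  rw [hcol]
  refine Nat.pow_le_pow_right (by omega) ?_
  -- `#P = ω(q/W) ≤ ω(q)`
  -- `#P = ω(q/W) ≤ ω(q)` (`ω n = #n.primeFactors`, cf. `card_primeFactors_eq_cardDistinctFactors` in
  -- `AsymptoticSieveForPrimesInputs.lean`, not imported here)
  rw [hPdef, ArithmeticFunction.cardDistinctFactors_apply, ← List.card_toFinset]
  exact Finset.card_le_card (Nat.primeFactors_mono (Nat.div_dvd_of_dvd hWq) hqpos.ne')

/-- Regrouping a sum over pairs by their modulus, with the multiplicity bound: for `g ≥ 0` and pairs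
with moduli in `[1, Q]`, `∑_{(d,d')} g(q_{W,d,d'}) ≤ ∑_{q ≤ Q} (3k+1)^{ω(q)} g(q)` (Polymath 8b p. 14:
"Thus this contribution is `≪ ∑_{q ≲ x^ϑ} τ(q)^{O(1)} sup_a |Δ(…; a (q))|`"). [cite: Polymath8b2014, §4.2, p. 14] -/
theorem sum_modulusOf_le {W : ℕ} (hW : 0 < W) (S : Finset ((ι → ℕ) × (ι → ℕ)))
    (hS : ∀ t ∈ S, LcmCoprime W t.1 t.2 ∧ ∀ i, Squarefree (t.1 i) ∧ Squarefree (t.2 i))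
    {Q : ℕ} (hQ : ∀ t ∈ S, modulusOf W t ∈ Finset.Icc 1 Q) {g : ℕ → ℝ} (hg : ∀ q, 0 ≤ g q) :
    ∑ t ∈ S, g (modulusOf W t) ≤ ∑ q ∈ Finset.Icc 1 Q, ((3 * Fintype.card ι + 1 : ℕ) : ℝ) ^ ω q * g q := by
  classical
  rw [Finset.sum_comp]
  calc ∑ q ∈ S.image (modulusOf W), (#(S.filter fun t => modulusOf W t = q) : ℕ) • g q
      ≤ ∑ q ∈ S.image (modulusOf W), ((3 * Fintype.card ι + 1 : ℕ) : ℝ) ^ ω q * g q := by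
        refine Finset.sum_le_sum fun q _ => ?_
        rw [nsmul_eq_mul]
        refine mul_le_mul_of_nonneg_right ?_ (hg q)
        exact_mod_cast card_filter_modulusOf_le hW S hS q
    _ ≤ ∑ q ∈ Finset.Icc 1 Q, ((3 * Fintype.card ι + 1 : ℕ) : ℝ) ^ ω q * g q := by
        refine Finset.sum_le_sum_of_subset_of_nonneg (fun q hq => ?_) (fun q _ _ => by
          exact mul_nonneg (by positivity) (hg q))
        obtain ⟨t, ht, rfl⟩ := Finset.mem_image.1 hq
        exact hQ t ht

/-! ### `φ(q_{W,d,d'}) = φ(W) ∏ φ([d_i,d'_i])` -/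

omit [Fintype ι] in
/-- `φ(∏_{i ∈ s} f i) = ∏_{i ∈ s} φ(f i)` for pairwise coprime `f i`. [folklore] -/
theorem totient_prod_of_coprime (s : Finset ι) (f : ι → ℕ)
    (h : ∀ i ∈ s, ∀ j ∈ s, i ≠ j → Nat.Coprime (f i) (f j)) :
    Nat.totient (∏ i ∈ s, f i) = ∏ i ∈ s, Nat.totient (f i) := by
  induction s using Finset.induction_on with
  | empty => simp
  | insert a s ha ih =>
    rw [Finset.prod_insert ha, Finset.prod_insert ha, Nat.totient_mul, ih]
    · exact fun i hi j hj hij => h i (Finset.mem_insert_of_mem hi) j (Finset.mem_insert_of_mem hj) hij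
    · exact Nat.Coprime.prod_right fun i hi =>
        h a (Finset.mem_insert_self a s) i (Finset.mem_insert_of_mem hi) (fun hai => ha (hai ▸ hi))

/-- **`φ(q_{W,d,d'}) = φ(W) ∏_i φ([d_i,d'_i])`** under the coprimality condition (the main term
`1/φ(q_{W,d_1,…,d'_{k-1}})` of (ts) "by Lemma 4.1" with `φ([d_j,d'_j])` denominators, Polymath 8b p. 13).
[cite: Polymath8b2014, §4.2, (ts)] -/
theorem totient_modulusOf {W : ℕ} {t : (ι → ℕ) × (ι → ℕ)} (h : LcmCoprime W t.1 t.2) :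
    Nat.totient (modulusOf W t) = Nat.totient W * ∏ i, Nat.totient (Nat.lcm (t.1 i) (t.2 i)) := by
  rw [modulusOf, Nat.totient_mul, totient_prod_of_coprime]
  · exact fun i _ j _ hij => h.1 i j hij
  · exact Nat.Coprime.prod_right fun i _ => (h.2 i).symm

/-! ### Concatenating the congruences: `n + h₀` in one primitive class modulo `q_{W,d,d'}` -/

/-- **The Chinese remainder step of §4.2** (Polymath 8b p. 13: "we may use the Chinese remainder
theorem to concatenate the congruence conditions on `n` into a single primitive congruence condition
`n + h_k = a_{W,d_1,…,d'_{k-1}} (q_{W,d_1,…,d'_{k-1}})`"): under the coprimality condition there is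
`a` with `(n ≡ b (W) ∧ ∀ i, [d_i,d'_i] ∣ n + h_i) ↔ n ≡ a (q_{W,d,d'})`. [cite: Polymath8b2014, §4.2, p. 13] -/
theorem exists_crt_modulusOf {W : ℕ} (b : ℤ) (h : ι → ℤ) {t : (ι → ℕ) × (ι → ℕ)}
    (hadm : LcmCoprime W t.1 t.2) :
    ∃ a : ℤ, ∀ n : ℤ, (n ≡ b [ZMOD W] ∧ ∀ i, ((Nat.lcm (t.1 i) (t.2 i) : ℕ) : ℤ) ∣ n + h i) ↔
      n ≡ a [ZMOD ((modulusOf W t : ℕ) : ℤ)] := by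
  obtain ⟨a, ha⟩ := exists_forall_modEq_iff_modEq_prod (Finset.univ : Finset ι) W
    (fun i => Nat.lcm (t.1 i) (t.2 i)) (fun i => -h i) b (fun i _ => hadm.2 i)
    (fun i _ j _ hij => hadm.1 i j hij)
  refine ⟨a, fun n => ?_⟩
  rw [modulusOf, ← ha n]
  refine and_congr_right fun _ => ⟨fun H i _ => ?_, fun H i => ?_⟩
  · exact (Int.modEq_iff_dvd.2 (by simpa [sub_neg_eq_add, add_comm] using H i)).symm
  · have := Int.modEq_iff_dvd.1 (H i (Finset.mem_univ i)).symm
    simpa [sub_neg_eq_add, add_comm] using this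

omit [DecidableEq ι] in
/-- The class `a + h₀` is primitive modulo `q_{W,d,d'}` as soon as `b + h₀` is coprime to `W` and no
prime factor of a `[d_i,d'_i]` divides `h₀ − h_i` ("single primitive congruence condition", Polymath 8b
p. 13; in the application the primes of `[d_i,d'_i]` exceed `w > |h₀ − h_i|`); stated for the natural
residue `r = (a + h₀) mod q`. [cite: Polymath8b2014, §4.2, p. 13] -/
theorem coprime_residue_modulusOf {W : ℕ} {b : ℤ} {h : ι → ℤ} {h₀ : ℤ} {t : (ι → ℕ) × (ι → ℕ)}
    (hq : 0 < modulusOf W t) {a : ℤ}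
    (ha : ∀ n : ℤ, (n ≡ b [ZMOD W] ∧ ∀ i, ((Nat.lcm (t.1 i) (t.2 i) : ℕ) : ℤ) ∣ n + h i) ↔
      n ≡ a [ZMOD ((modulusOf W t : ℕ) : ℤ)])
    (hb : Int.gcd (b + h₀) W = 1)
    (hh : ∀ i, ∀ p : ℕ, p.Prime → p ∣ Nat.lcm (t.1 i) (t.2 i) → ¬ (p : ℤ) ∣ h₀ - h i) :
    Nat.Coprime (((a + h₀) % (modulusOf W t : ℤ)).toNat) (modulusOf W t) := by
  set q : ℕ := modulusOf W t with hqdef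
  set r : ℕ := ((a + h₀) % (q : ℤ)).toNat with hrdef
  have hqz : (0 : ℤ) < (q : ℤ) := by exact_mod_cast hq
  have hrz : (r : ℤ) = (a + h₀) % (q : ℤ) := Int.toNat_of_nonneg (Int.emod_nonneg _ hqz.ne')
  obtain ⟨hab, hai⟩ := (ha a).2 (Int.ModEq.refl a)
  by_contra hne
  obtain ⟨p, hp, hpd⟩ := Nat.exists_prime_and_dvd hne
  have hpr : p ∣ r := hpd.trans (Nat.gcd_dvd_left r q)
  have hpq : p ∣ q := hpd.trans (Nat.gcd_dvd_right r q)
  have hp1 : (p : ℤ) ∣ a + h₀ := by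
    rw [← Int.emod_add_mul_ediv (a + h₀) (q : ℤ), ← hrz]
    exact dvd_add (Int.natCast_dvd_natCast.2 hpr) ((Int.natCast_dvd_natCast.2 hpq).mul_right _)
  have hpq' : p ∣ W * ∏ i, Nat.lcm (t.1 i) (t.2 i) := hpq
  rcases (Nat.Prime.prime hp).dvd_or_dvd hpq' with hpW | hpL
  · -- `p ∣ W`: then `p ∣ b + h₀`, contradicting `(b + h₀, W) = 1`
    have hWd : (W : ℤ) ∣ b - a := Int.modEq_iff_dvd.1 hab
    have hpb : (p : ℤ) ∣ b + h₀ := by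
      have h1 : (p : ℤ) ∣ b - a := (Int.natCast_dvd_natCast.2 hpW).trans hWd
      have : b + h₀ = (b - a) + (a + h₀) := by ring
      rw [this]; exact dvd_add h1 hp1
    have hpg : p ∣ Int.gcd (b + h₀) W := by
      rw [Int.gcd_eq_natAbs, Int.natAbs_natCast]
      exact Nat.dvd_gcd (Int.natCast_dvd.1 hpb) hpW
    rw [hb] at hpg
    exact hp.one_lt.ne' (Nat.dvd_one.1 hpg)
  · -- `p ∣ [d_i,d'_i]` for some `i`: then `p ∣ h₀ - h_i`
    obtain ⟨i, -, hpi⟩ := (Nat.Prime.prime hp).exists_mem_finset_dvd hpL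
    have hp3 : (p : ℤ) ∣ a + h i := (Int.natCast_dvd_natCast.2 hpi).trans (hai i)
    have : h₀ - h i = (a + h₀) - (a + h i) := by ring
    exact hh i p hp hpi (this ▸ dvd_sub hp1 hp3)

omit [DecidableEq ι] in
/-- **The count `S̃` as a `θ`-sum over one progression** (Polymath 8b, (theta-oo2)–(ts)): with `a`
as above, `N₁ + h₀ ≥ 1`,
`∑_{N₁ ≤ n ≤ N₂, n ≡ b (W), [d_i,d'_i] ∣ n+h_i ∀ i} θ(n + h₀) = ∑_{X₁ < m ≤ X₂, m ≡ r (q)} θ(m)` with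
`X₁ = N₁ + h₀ − 1`, `X₂ = N₂ + h₀`, `r = (a + h₀) mod q`. [cite: Polymath8b2014, §4.2, (ts)] -/
theorem sum_theta_eq_thetaAP {W : ℕ} (hW : 0 < W) {b : ℤ} {h : ι → ℤ} {h₀ : ℤ}
    {t : (ι → ℕ) × (ι → ℕ)} (hpos : ∀ i, 0 < t.1 i ∧ 0 < t.2 i) {a : ℤ}
    (ha : ∀ n : ℤ, (n ≡ b [ZMOD W] ∧ ∀ i, ((Nat.lcm (t.1 i) (t.2 i) : ℕ) : ℤ) ∣ n + h i) ↔
      n ≡ a [ZMOD ((modulusOf W t : ℕ) : ℤ)])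
    {N₁ N₂ : ℕ} (hN₁ : 1 ≤ (N₁ : ℤ) + h₀) :
    ∑ n ∈ ((Finset.Icc N₁ N₂).filter fun n : ℕ => (n : ℤ) ≡ b [ZMOD W]).filter
        (fun n : ℕ => ∀ i, ((Nat.lcm (t.1 i) (t.2 i) : ℕ) : ℤ) ∣ (n : ℤ) + h i),
      GPY.theta (((n : ℤ) + h₀).toNat) =
    thetaAP (modulusOf W t) (((a + h₀) % (modulusOf W t : ℤ)).toNat)
      (((N₁ : ℤ) + h₀ - 1).toNat) (((N₂ : ℤ) + h₀).toNat) := by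
  set q : ℕ := modulusOf W t with hqdef
  have hqpos : 0 < q := by
    rw [hqdef, modulusOf]
    exact Nat.mul_pos hW (Finset.prod_pos fun i _ => Nat.lcm_pos (hpos i).1 (hpos i).2)
  have hqz : (0 : ℤ) < (q : ℤ) := by exact_mod_cast hqpos
  set r : ℕ := ((a + h₀) % (q : ℤ)).toNat with hrdef
  have hr0 : (0 : ℤ) ≤ (a + h₀) % (q : ℤ) := Int.emod_nonneg _ hqz.ne'
  have hrz : (r : ℤ) = (a + h₀) % (q : ℤ) := Int.toNat_of_nonneg hr0
  have hrmod : (r : ℤ) ≡ a + h₀ [ZMOD q] := by rw [hrz]; exact Int.mod_modEq _ _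
  -- rewrite the double filter through the single congruence
  have hfilter : ((Finset.Icc N₁ N₂).filter fun n : ℕ => (n : ℤ) ≡ b [ZMOD W]).filter
        (fun n : ℕ => ∀ i, ((Nat.lcm (t.1 i) (t.2 i) : ℕ) : ℤ) ∣ (n : ℤ) + h i) =
      (Finset.Icc N₁ N₂).filter fun n : ℕ => (n : ℤ) ≡ a [ZMOD q] := by
    rw [Finset.filter_filter]
    exact Finset.filter_congr fun n _ => ha n
  rw [hfilter, thetaAP]
  -- the bijection `n ↦ n + h₀`
  refine Finset.sum_nbij' (fun n : ℕ => ((n : ℤ) + h₀).toNat) (fun m : ℕ => ((m : ℤ) - h₀).toNat)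
    ?_ ?_ ?_ ?_ ?_
  · intro n hn
    rw [Finset.mem_filter, Finset.mem_Icc] at hn
    obtain ⟨⟨hn1, hn2⟩, hna⟩ := hn
    have hn0 : 0 ≤ (n : ℤ) + h₀ := by omega
    rw [Finset.mem_filter, Finset.mem_Ioc]
    refine ⟨⟨?_, ?_⟩, ?_⟩
    · zify; rw [Int.toNat_of_nonneg hn0]; omega
    · zify; rw [Int.toNat_of_nonneg hn0]; omega
    · rw [← Int.natCast_modEq_iff, Int.toNat_of_nonneg hn0]
      exact (hna.add_right h₀).trans hrmod.symm
  · intro m hm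
    rw [Finset.mem_filter, Finset.mem_Ioc] at hm
    obtain ⟨⟨hm1, hm2⟩, hmr⟩ := hm
    have hm0 : 0 ≤ (m : ℤ) - h₀ := by omega
    rw [Finset.mem_filter, Finset.mem_Icc]
    refine ⟨⟨?_, ?_⟩, ?_⟩
    · zify; rw [Int.toNat_of_nonneg hm0]; omega
    · zify; rw [Int.toNat_of_nonneg hm0]; omega
    · rw [Int.toNat_of_nonneg hm0]
      have h1 : (m : ℤ) ≡ a + h₀ [ZMOD q] := (Int.natCast_modEq_iff.2 hmr).trans hrmod
      have := h1.sub_right h₀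
      simpa using this
  · intro n hn
    rw [Finset.mem_filter, Finset.mem_Icc] at hn
    have hn0 : 0 ≤ (n : ℤ) + h₀ := by omega
    simp only [Int.toNat_of_nonneg hn0, add_sub_cancel_right, Int.toNat_natCast]
  · intro m hm
    rw [Finset.mem_filter, Finset.mem_Ioc] at hm
    have hm0 : 0 ≤ (m : ℤ) - h₀ := by omega
    simp only [Int.toNat_of_nonneg hm0, sub_add_cancel, Int.toNat_natCast]
  · intro n hn
    rfl

end LcmEuler

end Literature.NumberTheory.Sieve
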